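import Summits.BirchSwinnertonDyer.BirchSwinnertonDyer.Theorems.ResidualThetaTransportAtTwoRlfTwistedCasselsOfEventualLevelTwo
import HarnessLib

/-!
# Road T for item 23110, (R6)-glue (C) at `ℚ`/`2`: the residual `λ`-formula `#R♯_{S₀}(E) = 2^{λ(X⁺) + Σ N_v d_v}` for ONE curve of ANY
# rank from (ii) + (LIFT⁺₂) + the EVENTUAL-level twisted Cassels statement (TCAS-K)_ev — `rlf2_of_twistedDescent` with its (TCAS♯)
# hypothesis DISCHARGED by `twistedCassels_sharp_two_of_eventualLevel`

Route `ResidualThetaTransportAtTwo` (RTT, crux r201 `ResidualLambdaFormulaNegDiscAtTwo`, stmt-BirchSwinnertonDyer-23110) /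
`ThetaPartnerAtTwo` (TP2). Seat `prover-bsd-wall-tp2-p2x-w3` g12 (the lead tp2-p2x g12's (R6) ask (C)); `--supports
stmt-BirchSwinnertonDyer-23110`. THEOREMS ONLY (no definition, no named fact, no `sorry`); route-independent; closes nothing.

* `rlf2_of_twistedEventualLevelDescent` — the lead's `SignedEC.TwistedSurj.rlf2_of_twistedDescent` (p654602: one curve, `c = 0`,
  from (ii) `hH`, (LIFT⁺₂) `hlift`, (TCAS♯) `htwCas`) with `htwCas` replaced by the eventual-level (TCAS-K)_ev `hlev` of
  `SignedEC.TwistedSurj.twistedCassels_sharp_of_eventualLevel` (p657379), through (B) `twistedCassels_sharp_two_of_eventualLevel`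
  (this seat: the twisted local `Γ`-descent at `S₀` is a theorem, the generating clause is the exact local index). Remaining displayed
  research inputs of road T after this file: (ii) — supplied generically in `u` by PRINT {WL@2, Prop. 4.12}
  (`exists_twistedCoinv_H1Sigma_of_print`), (LIFT⁺₂) = (R3)+(R5') at the place above `2`, and (TCAS-K)_ev = (R5').

HONEST FRAMING: CONDITIONAL on the displayed hypotheses; closes nothing; 23110 is NOT proved; BSD is not proved by any of this.
References: [GreenbergLNM1716] §4 Props. 4.12–4.14 and Remark (pp. 119–124); [GreenbergVatsal2000] §2 Prop. (2.1), (10); [BDKim2013] Thm. 1.1.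
-/

set_option autoImplicit false
set_option linter.dupNamespace false

noncomputable section

open scoped Classical NumberField AddSubgroup

open NumberField IsDedekindDomain

namespace Summit.BirchSwinnertonDyer.BirchSwinnertonDyer.Theorems.SignedEC.TwistedLocalDescent

open Literature.NumberTheory.EllipticCurves Literature.NumberTheory.GaloisRepresentations
  WeierstrassCurve ZpExtension Literature.NumberTheory.EllipticCurves.Kobayashi2003
  Literature.NumberTheory.EllipticCurves.GreenbergVatsal2000 Literature.NumberTheory.EllipticCurves.GreenbergSelmer
  Literature.NumberTheory.EllipticCurves.Rank1Residual

/-- **`#R♯_{S₀}(E) = 2^{λ(X⁺) + Σ_{v ∈ S₀} N_v d_v(E, 2)}` for ONE curve of ANY rank, from (ii) + (LIFT⁺₂) + (TCAS-K)_ev.**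
`κ` cyclotomic with topological generator `γ`, `S₀ ∌ 2` finite containing the bad places, `E/ℚ` globally minimal good supersingular at `2`
with `a₂ = 0` and `Δ < 0`, `D` a `+` dual datum with `X⁺` finitely generated torsion and `μ = 0`, `u` odd with (ii) `hH`, (LIFT⁺₂)
`hlift` and the eventual-level twisted Cassels statement `hlev`: the count of `rlf2_of_twistedDescent`, its (TCAS♯) input supplied by
`twistedCassels_sharp_two_of_eventualLevel`. [cite: GreenbergLNM1716, §4 Props. 4.12–4.14 (pp. 119–124)] [cite: GreenbergVatsal2000, §2 Prop. (2.1)] -/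
theorem rlf2_of_twistedEventualLevelDescent (κ : ZpExtension ℚ 2) (γ : Field.absoluteGaloisGroup ℚ) (hκ : κ.IsCyclotomic)
    (hγ : κ.IsTopGenerator γ) (S₀ : Finset (HeightOneSpectrum (𝓞 ℚ))) (hS2 : ∀ v ∈ S₀, ((2 : ℕ) : 𝓞 ℚ) ∉ v.asIdeal)
    (E : WeierstrassCurve ℚ) [E.IsElliptic] [E.IsGloballyMinimal] (hss : GoodSS E 2) (ha2 : E.frobeniusTrace 2 = 0)
    (hΔ : E.Δ < 0)
    (hS : ∀ v : HeightOneSpectrum (𝓞 ℚ), ¬ E.HasGoodReductionAt v → v ∈ S₀)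
    (D : SignedSelmerDualData E κ γ 1) [Module.Finite (IwasawaAlgebra 2) D.X]
    (hT : Module.IsTorsion (IwasawaAlgebra 2) D.X) (hμ : D.mu = 0)
    {u : ℤ} (hu : ((2 : ℕ) : ℤ) ∣ u - 1)
    (hH : ∀ h ∈ unramifiedOutside κ.kerSubgroup ↥(E.geomPrimaryTorsion 2) 2 (↑S₀ : Set (HeightOneSpectrum (𝓞 ℚ))),
      ∃ h' ∈ unramifiedOutside κ.kerSubgroup ↥(E.geomPrimaryTorsion 2) 2 (↑S₀ : Set (HeightOneSpectrum (𝓞 ℚ))),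
        u • E.conjH1 2 κ.kerSubgroup γ h' - h' = h)
    (hlift : ∀ c ∈ unramifiedOutside κ.kerSubgroup ↥(E.geomPrimaryTorsion 2) 2 (↑S₀ : Set (HeightOneSpectrum (𝓞 ℚ))),
      u • E.conjH1 2 κ.kerSubgroup γ c - c ∈
        ⨅ (v : HeightOneSpectrum (𝓞 ℚ)) (_ : ((2 : ℕ) : 𝓞 ℚ) ∈ v.asIdeal) (σ : Field.absoluteGaloisGroup ℚ),
          (localKummerOverOfEmb E 2 κ.kerSubgroup (closureEmb (K := ℚ) (v.adicCompletion ℚ))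
            (⨆ n : ℕ, signedLocalPoints κ (v.adicCompletion ℚ) E 1 n)).comap (E.conjH1 2 κ.kerSubgroup σ) →
      ∃ c' ∈ unramifiedOutside κ.kerSubgroup ↥(E.geomPrimaryTorsion 2) 2 (↑S₀ : Set (HeightOneSpectrum (𝓞 ℚ))),
        u • E.conjH1 2 κ.kerSubgroup γ c' = c' ∧ c - c' ∈
          ⨅ (v : HeightOneSpectrum (𝓞 ℚ)) (_ : ((2 : ℕ) : 𝓞 ℚ) ∈ v.asIdeal) (σ : Field.absoluteGaloisGroup ℚ),
            (localKummerOverOfEmb E 2 κ.kerSubgroup (closureEmb (K := ℚ) (v.adicCompletion ℚ))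
              (⨆ n : ℕ, signedLocalPoints κ (v.adicCompletion ℚ) E 1 n)).comap (E.conjH1 2 κ.kerSubgroup σ))
    (hlev : ∀ (J : ℕ) (t : ∀ v : HeightOneSpectrum (𝓞 ℚ),
        galoisCohomology ((E.twistedTorsionGaloisModule 2 κ J u hu).restrictField (v.adicCompletion ℚ)) 1),
      ∃ (J' : ℕ) (hJ : J ≤ J') (x : galoisCohomology (E.twistedTorsionGaloisModule 2 κ J' u hu) 1),
        E.twistedTorsionToH1 2 κ J' u hu x ∈
            unramifiedOutside κ.kerSubgroup ↥(E.geomPrimaryTorsion 2) 2 (↑S₀ : Set (HeightOneSpectrum (𝓞 ℚ))) ⊓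
              ⨅ (v : HeightOneSpectrum (𝓞 ℚ)) (_ : ((2 : ℕ) : 𝓞 ℚ) ∈ v.asIdeal) (σ : Field.absoluteGaloisGroup ℚ),
                (localKummerOverOfEmb E 2 κ.kerSubgroup (closureEmb (K := ℚ) (v.adicCompletion ℚ))
                  (⨆ n : ℕ, signedLocalPoints κ (v.adicCompletion ℚ) E 1 n)).comap (E.conjH1 2 κ.kerSubgroup σ) ∧
          ∀ v ∈ S₀, galoisCohomology.res (E.twistedTorsionGaloisModule 2 κ J' u hu) (v.adicCompletion ℚ) 1 x =
            galoisCohomology.map ((E.twistedTorsionIncl 2 κ hJ u hu).restrictField (v.adicCompletion ℚ)) 1 (t v)) :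
    {x : subgroupH1 κ.kerSubgroup ↥((↥(E.geomPrimaryTorsion 2))[(2 : ℤ)]) |
        x ∈ unramifiedOutside κ.kerSubgroup ↥((↥(E.geomPrimaryTorsion 2))[(2 : ℤ)]) 2
            (↑S₀ : Set (HeightOneSpectrum (𝓞 ℚ))) ∧
          (∀ (w : InfinitePlace ℚ) (σ : Field.absoluteGaloisGroup ℚ),
            Literature.NumberTheory.EllipticCurves.conjH1 κ.kerSubgroup ↥((↥(E.geomPrimaryTorsion 2))[(2 : ℤ)]) σ x ∈
              GreenbergSelmer.infKer κ.kerSubgroup ↥((↥(E.geomPrimaryTorsion 2))[(2 : ℤ)]) w) ∧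
          (∀ (v : HeightOneSpectrum (𝓞 ℚ)), ((2 : ℕ) : 𝓞 ℚ) ∈ v.asIdeal → ∀ σ : Field.absoluteGaloisGroup ℚ,
            E.conjH1 2 κ.kerSubgroup σ
                (pushH1 κ.kerSubgroup ((↥(E.geomPrimaryTorsion 2))[(2 : ℤ)]).subtype (SignedTransportAtTwo.subtype_torsionBy_smul E 2) x) ∈
              localKummerOverOfEmb E 2 κ.kerSubgroup (closureEmb (K := ℚ) (v.adicCompletion ℚ))
                (⨆ n : ℕ, signedLocalPoints κ (v.adicCompletion ℚ) E 1 n))}.ncard =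
      2 ^ (lambdaInvariant 2 D.X +
        ∑ v ∈ S₀, 2 ^ padicValNat 2 ((Rat.HeightOneSpectrum.natGenerator v ^ 2 - 1) / 8) * dMultiplicity E 2 v) :=
  TwistedSurj.rlf2_of_twistedDescent κ γ hκ hγ S₀ hS2 E hss ha2 hΔ hS D hT hμ (by exact_mod_cast hu) hH hlift
    (twistedCassels_sharp_two_of_eventualLevel κ γ hκ hγ S₀ hS2 E hu hlev)

end Summit.BirchSwinnertonDyer.BirchSwinnertonDyer.Theorems.SignedEC.TwistedLocalDescent

end
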